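import Summits.CriticalPhenomena.PercolationContinuityZ3.Theorems.PercNearOneGluingNoHeavyLowerTailKnQuestion8CoefficientwiseZoneFlip
import HarnessLib

/-!
# The zone-flip (Klein-four) reduction of coefficientwise conditional association: CW-PA ≥ ½·DOM_z, hence CW-PA ⟸ DOM_z ≥ 0

Support file (`--supports stmt-CriticalPhenomena-4575`, closed), prover `prim-cplus-coupling` (gen 26).  No definitions, no notations, no named
facts, no sorries; standard axioms.  Memo `prim-cplus-coupling/A5-COUPLING-gen26.md` §5 (Theorem K).  Companion: `…CoefficientwiseZoneFlip` (the
involution `P_z` and the zone cells).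

The first open rung of prim-lf-2's coefficientwise programme (CW-PA, CW-PROGRAMME-gen21; = DOM of prim-cplus-coupling gen 22–25) is, for the uniform
two-colouring `s / sᶜ` of the edges of a finite multigraph `ends : ι → Sym2 V`, `S = {z ∉ C_x(s)} ∩ {z ∉ C_x(sᶜ)}` and monotone `f, g`,
  `0 ≤ Σ_{s ∈ S} (f(C_x s) − f(C_x sᶜ))·(g(C_x s) − g(C_x sᶜ))  ( = 2·Σ_{s ∈ S} f(C_x s)·(g(C_x s) − g(C_x sᶜ)) )`.
With the zone flip `P_z s = s ∆ Q(s)` (recolour every edge meeting `C_z(s) ∪ C_z(sᶜ)`; an involution of `S`, companion file):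
* **`Coefficientwise.cwpa_ge_half_zoneFlip`** (Theorem K) —
  `Σ_{s∈S} (f(C_x s) − f(C_x(P_z s)))·(g(C_x s) − g(C_x(P_z s))) ≤ 2·Σ_{s∈S} f(C_x s)·(g(C_x s) − g(C_x sᶜ))`,
  i.e. `CW-PA(f,g) = ½·DOM_z(f,g) + H` with `H = Σ_S f(C_x(P_z s))·(g(C_x s) − g(C_x((P_z s)ᶜ))) ≥ 0`.  Proof: `g(K) − g(K̄) = [g(K) − g(K∘P_z)] +
  [g(K∘P_z) − g(K̄)]`; reindex the second part by `P_z`; on a zone cell `{t | t ∩ Q = π}` one has `P_z t = (Q∖π) ∪ (t∖Q)` and `(P_z t)ᶜ = π ∪ (tᶜ∖Q)`,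
  so `H` restricted to the cell is `Σ Φ(t)(G(t) − G(π ∪ (tᶜ∖Q)))` with `Φ, G` monotone — nonnegative by `cell_sum_mul_flip_le` (Harris twice).
* `Coefficientwise.cwpa_of_zoneFlip_nonneg` — the corollary `DOM_z(f,g) ≥ 0 ⟹ CW-PA(f,g) ≥ 0`.
So CW-PA is implied by the positivity of the 'co-monotone' comparison `DOM_z` of `C_x(s)` with `C_x(P_z s)`: two red clusters sharing the colour of
every edge off the zone of `z` and differing only in WHICH boundary of `z`'s two clusters is red (census, memo §5.3: `DOM_z ≥ 0` in all 37,833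
graphs with ≤ 6 vertices and ≤ 6 edges and in random graphs / hypergraphs up to 8 vertices; its per-cell version fails, its sum does not).
[cite: KozmaNitzan2024, Questions 8–9 (§5.5 p. 36) (context: the Question-8 pocket covariance programme)]
-/

namespace Summit.CriticalPhenomena.PercolationContinuityZ3.Theorems

open Finset Literature.Probability.Percolation

namespace Coefficientwise

variable {ι V : Type*} [Fintype ι] [DecidableEq ι]
variable (ends : ι → Sym2 V) (z : V)




open Classical in
/-- **Theorem K (zone-flip / Klein-four reduction of CW-PA).**  For a finite multigraph `ends : ι → Sym2 V`, vertices `x, z`, monotone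
`f, g : Set V → ℝ`, `S = {s | z ∉ C_x(s), z ∉ C_x(sᶜ)}` and the zone flip `P_z s = s ∆ Q(s)`:
  `Σ_{s∈S} (f(C_x s) − f(C_x(P_z s)))·(g(C_x s) − g(C_x(P_z s))) ≤ 2·Σ_{s∈S} f(C_x s)·(g(C_x s) − g(C_x sᶜ))`.
Proof: `g(K) − g(K̄) = [g(K) − g(K∘P_z)] + [g(K∘P_z) − g(K̄)]`; reindex the second part by the involution `P_z` of `S` to get
`H = Σ_S f(C_x(P_z s))·(g(C_x s) − g(C_x((P_z s)ᶜ)))`; split `S` into the cells of the zone (`zone_locality`), on which `P_z t = (Q∖π) ∪ (t∖Q)` and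
`(P_z t)ᶜ = π ∪ (tᶜ∖Q)`, and apply `cell_sum_mul_flip_le`: `H ≥ 0`. [this work] -/
theorem cwpa_ge_half_zoneFlip (x : V) (f g : Set V → ℝ) (hf : Monotone f) (hg : Monotone g) :
    ∑ s ∈ univ.filter (fun s : Finset ι => z ∉ (openCluster (ends '' (↑(s) : Set ι)) (x)) ∧ z ∉ (openCluster (ends '' (↑(sᶜ) : Set ι)) (x))),
        (f (openCluster (ends '' (↑(s) : Set ι)) (x)) - f (openCluster (ends '' (↑((symmDiff (s) (Finset.univ.filter (fun i : ι => ∃ v, (v ∈ (openCluster (ends '' (↑(s) : Set ι)) (z)) ∨ v ∈ (openCluster (ends '' (↑((s)ᶜ) : Set ι)) (z))) ∧ v ∈ ends i)))) : Set ι)) (x))) * (g (openCluster (ends '' (↑(s) : Set ι)) (x)) - g (openCluster (ends '' (↑((symmDiff (s) (Finset.univ.filter (fun i : ι => ∃ v, (v ∈ (openCluster (ends '' (↑(s) : Set ι)) (z)) ∨ v ∈ (openCluster (ends '' (↑((s)ᶜ) : Set ι)) (z))) ∧ v ∈ ends i)))) : Set ι)) (x))) ≤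
      2 * ∑ s ∈ univ.filter (fun s : Finset ι => z ∉ (openCluster (ends '' (↑(s) : Set ι)) (x)) ∧ z ∉ (openCluster (ends '' (↑(sᶜ) : Set ι)) (x))),
        f (openCluster (ends '' (↑(s) : Set ι)) (x)) * (g (openCluster (ends '' (↑(s) : Set ι)) (x)) - g (openCluster (ends '' (↑(sᶜ) : Set ι)) (x))) := by
  -- notation
  set K : Finset ι → Set V := fun s => (openCluster (ends '' (↑(s) : Set ι)) (x)) with hK
  set F : Finset ι → ℝ := fun s => f (K s) with hF
  set G : Finset ι → ℝ := fun s => g (K s) with hG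
  set P : Finset ι → Finset ι := fun s => (symmDiff (s) (Finset.univ.filter (fun i : ι => ∃ v, (v ∈ (openCluster (ends '' (↑(s) : Set ι)) (z)) ∨ v ∈ (openCluster (ends '' (↑((s)ᶜ) : Set ι)) (z))) ∧ v ∈ ends i))) with hP
  set S : Finset (Finset ι) := univ.filter (fun s : Finset ι => z ∉ (openCluster (ends '' (↑(s) : Set ι)) (x)) ∧ z ∉ (openCluster (ends '' (↑(sᶜ) : Set ι)) (x))) with hS
  change ∑ s ∈ S, (F s - F (P s)) * (G s - G (P s)) ≤ 2 * ∑ s ∈ S, F s * (G s - G sᶜ)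
  have hKmono : ∀ {s t : Finset ι}, s ⊆ t → K s ⊆ K t := fun hst => openCluster_image_mono ends hst x
  have hFm : Monotone F := fun s t hst => hf (hKmono hst)
  have hGm : Monotone G := fun s t hst => hg (hKmono hst)
  have mem_S : ∀ s, s ∈ S ↔ z ∉ (openCluster (ends '' (↑(s) : Set ι)) (x)) ∧ z ∉ (openCluster (ends '' (↑(sᶜ) : Set ι)) (x)) := fun s => by simp [hS]
  have hPP : ∀ s, P (P s) = s := fun s => zoneFlip_zoneFlip ends z s
  have hPS : ∀ s ∈ S, P s ∈ S := fun s hs =>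
    (mem_S _).mpr (zoneFlip_mem ends z x s ((mem_S s).mp hs).1 ((mem_S s).mp hs).2)
  -- reindexing by the involution `P`
  have reindexP : ∀ Ψ : Finset ι → ℝ, ∑ s ∈ S, Ψ (P s) = ∑ s ∈ S, Ψ s := by
    intro Ψ
    refine Finset.sum_bij' (fun s _ => P s) (fun s _ => P s) ?_ ?_ ?_ ?_ ?_
    · intro s hs; exact hPS s hs
    · intro s hs; exact hPS s hs
    · intro s hs; exact hPP s
    · intro s hs; exact hPP s
    · intro s hs; rfl
  -- step 1: symmetrisation of the left-hand side
  have step1 : ∑ s ∈ S, (F s - F (P s)) * (G s - G (P s)) = 2 * ∑ s ∈ S, F s * (G s - G (P s)) := by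
    have e : ∀ s, (F s - F (P s)) * (G s - G (P s)) = F s * (G s - G (P s)) + F (P s) * (G (P s) - G s) := fun s => by ring
    simp only [e, Finset.sum_add_distrib]
    have h2 : ∑ s ∈ S, F (P s) * (G (P s) - G s) = ∑ s ∈ S, F s * (G s - G (P s)) := by
      have := reindexP (fun s => F s * (G s - G (P s)))
      -- Σ_S F(P s)(G(P s) − G(P (P s))) = Σ_S F s (G s − G (P s))
      rw [← this]
      refine Finset.sum_congr rfl fun s _ => ?_
      simp only [hPP]
    rw [h2]; ring
  -- step 2: CW-PA = (first part) + H
  have step2 : ∑ s ∈ S, F s * (G s - G sᶜ) = ∑ s ∈ S, F s * (G s - G (P s)) + ∑ s ∈ S, F (P s) * (G s - G (P s)ᶜ) := by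
    have e : ∀ s, F s * (G s - G sᶜ) = F s * (G s - G (P s)) + F s * (G (P s) - G sᶜ) := fun s => by ring
    simp only [e, Finset.sum_add_distrib]
    congr 1
    have := reindexP (fun s => F (P s) * (G s - G (P s)ᶜ))
    rw [← this]
    refine Finset.sum_congr rfl fun s _ => ?_
    simp only [hPP]
  -- step 3: H ≥ 0 by cells
  have step3 : 0 ≤ ∑ s ∈ S, F (P s) * (G s - G (P s)ᶜ) := by
    set key : Finset ι → Finset ι × Finset ι := fun s => ((Finset.univ.filter (fun i : ι => ∃ v, (v ∈ (openCluster (ends '' (↑(s) : Set ι)) (z)) ∨ v ∈ (openCluster (ends '' (↑((s)ᶜ) : Set ι)) (z))) ∧ v ∈ ends i)), s ∩ (Finset.univ.filter (fun i : ι => ∃ v, (v ∈ (openCluster (ends '' (↑(s) : Set ι)) (z)) ∨ v ∈ (openCluster (ends '' (↑((s)ᶜ) : Set ι)) (z))) ∧ v ∈ ends i))) with hkey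
    rw [← Finset.sum_fiberwise_of_maps_to (s := S) (t := S.image key) (g := key)
      (fun s hs => Finset.mem_image_of_mem key hs)]
    refine Finset.sum_nonneg fun k hk => ?_
    obtain ⟨s₀, hs₀S, rfl⟩ := Finset.mem_image.mp hk
    set B : Finset ι := (Finset.univ.filter (fun i : ι => ∃ v, (v ∈ (openCluster (ends '' (↑(s₀) : Set ι)) (z)) ∨ v ∈ (openCluster (ends '' (↑((s₀)ᶜ) : Set ι)) (z))) ∧ v ∈ ends i)) with hB
    set π : Finset ι := s₀ ∩ B with hπ
    have hπB : π ⊆ B := Finset.inter_subset_right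
    -- the fibre is the cell
    have fiber_eq : S.filter (fun t => key t = key s₀) = univ.filter (fun t : Finset ι => t ∩ B = π) := by
      ext t
      simp only [Finset.mem_filter, Finset.mem_univ, true_and]
      constructor
      · rintro ⟨_, hkt⟩
        have h1 : (Finset.univ.filter (fun i : ι => ∃ v, (v ∈ (openCluster (ends '' (↑(t) : Set ι)) (z)) ∨ v ∈ (openCluster (ends '' (↑((t)ᶜ) : Set ι)) (z))) ∧ v ∈ ends i)) = B := (Prod.ext_iff.mp hkt).1
        have h2 : t ∩ (Finset.univ.filter (fun i : ι => ∃ v, (v ∈ (openCluster (ends '' (↑(t) : Set ι)) (z)) ∨ v ∈ (openCluster (ends '' (↑((t)ᶜ) : Set ι)) (z))) ∧ v ∈ ends i)) = s₀ ∩ (Finset.univ.filter (fun i : ι => ∃ v, (v ∈ (openCluster (ends '' (↑(s₀) : Set ι)) (z)) ∨ v ∈ (openCluster (ends '' (↑((s₀)ᶜ) : Set ι)) (z))) ∧ v ∈ ends i)) := (Prod.ext_iff.mp hkt).2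
        rw [h1] at h2
        exact h2
      · intro ht
        have hloc := zone_locality ends z s₀ t ht
        have hQt : (Finset.univ.filter (fun i : ι => ∃ v, (v ∈ (openCluster (ends '' (↑(t) : Set ι)) (z)) ∨ v ∈ (openCluster (ends '' (↑((t)ᶜ) : Set ι)) (z))) ∧ v ∈ ends i)) = B := by
          rw [hB]; ext i
          simp only [Finset.mem_filter, Finset.mem_univ, true_and, hloc.1, hloc.2]
        refine ⟨?_, ?_⟩
        · rw [mem_S]
          have h0 := (mem_S s₀).mp hs₀S
          constructor
          · intro hz
            have hx : x ∈ (openCluster (ends '' (↑(t) : Set ι)) (z)) := SimpleGraph.Reachable.symm hz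
            rw [hloc.1] at hx
            exact h0.1 (SimpleGraph.Reachable.symm hx)
          · intro hz
            have hx : x ∈ (openCluster (ends '' (↑(tᶜ) : Set ι)) (z)) := SimpleGraph.Reachable.symm hz
            rw [hloc.2] at hx
            exact h0.2 (SimpleGraph.Reachable.symm hx)
        · change ((Finset.univ.filter (fun i : ι => ∃ v, (v ∈ (openCluster (ends '' (↑(t) : Set ι)) (z)) ∨ v ∈ (openCluster (ends '' (↑((t)ᶜ) : Set ι)) (z))) ∧ v ∈ ends i)), t ∩ (Finset.univ.filter (fun i : ι => ∃ v, (v ∈ (openCluster (ends '' (↑(t) : Set ι)) (z)) ∨ v ∈ (openCluster (ends '' (↑((t)ᶜ) : Set ι)) (z))) ∧ v ∈ ends i))) = ((Finset.univ.filter (fun i : ι => ∃ v, (v ∈ (openCluster (ends '' (↑(s₀) : Set ι)) (z)) ∨ v ∈ (openCluster (ends '' (↑((s₀)ᶜ) : Set ι)) (z))) ∧ v ∈ ends i)), s₀ ∩ (Finset.univ.filter (fun i : ι => ∃ v, (v ∈ (openCluster (ends '' (↑(s₀) : Set ι)) (z)) ∨ v ∈ (openCluster (ends '' (↑((s₀)ᶜ)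 : Set ι)) (z))) ∧ v ∈ ends i)))
          rw [hQt]
          exact Prod.ext rfl ht
    rw [fiber_eq]
    -- on the cell, `P t = (B \ π) ∪ (t \ B)` and `(P t)ᶜ = π ∪ (tᶜ \ B)`
    have hPcell : ∀ t : Finset ι, t ∩ B = π → P t = (B \ π) ∪ (t \ B) := by
      intro t ht
      have hloc := zone_locality ends z s₀ t ht
      have hQt : (Finset.univ.filter (fun i : ι => ∃ v, (v ∈ (openCluster (ends '' (↑(t) : Set ι)) (z)) ∨ v ∈ (openCluster (ends '' (↑((t)ᶜ) : Set ι)) (z))) ∧ v ∈ ends i)) = B := by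
        rw [hB]; ext i
        simp only [Finset.mem_filter, Finset.mem_univ, true_and, hloc.1, hloc.2]
      have facts : ∀ i, (i ∈ π ↔ i ∈ t ∧ i ∈ B) := fun i => by rw [← ht]; exact Finset.mem_inter
      change symmDiff t (Finset.univ.filter (fun i : ι => ∃ v, (v ∈ (openCluster (ends '' (↑(t) : Set ι)) (z)) ∨ v ∈ (openCluster (ends '' (↑((t)ᶜ) : Set ι)) (z))) ∧ v ∈ ends i)) = (B \ π) ∪ (t \ B)
      rw [hQt]
      ext i
      simp only [Finset.mem_symmDiff, Finset.mem_union, Finset.mem_sdiff]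
      have := facts i
      tauto
    have hPccell : ∀ t : Finset ι, t ∩ B = π → (P t)ᶜ = π ∪ (tᶜ \ B) := by
      intro t ht
      rw [hPcell t ht]
      have facts : ∀ i, (i ∈ π ↔ i ∈ t ∧ i ∈ B) := fun i => by rw [← ht]; exact Finset.mem_inter
      ext i
      simp only [Finset.mem_compl, Finset.mem_union, Finset.mem_sdiff]
      have := facts i
      have h2 : i ∈ π → i ∈ B := fun h => hπB h
      tauto
    set Φ : Finset ι → ℝ := fun t => F ((B \ π) ∪ (t \ B)) with hΦ
    have hΦm : Monotone Φ := by
      intro s t hst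
      simp only [hΦ]
      exact hFm (Finset.union_subset_union (le_refl _) (Finset.sdiff_subset_sdiff hst (le_refl _)))
    have hsum : ∑ t ∈ univ.filter (fun t : Finset ι => t ∩ B = π), F (P t) * (G t - G (P t)ᶜ) =
        ∑ t ∈ univ.filter (fun t : Finset ι => t ∩ B = π), Φ t * G t -
          ∑ t ∈ univ.filter (fun t : Finset ι => t ∩ B = π), Φ t * G (π ∪ (tᶜ \ B)) := by
      rw [← Finset.sum_sub_distrib]
      refine Finset.sum_congr rfl fun t ht => ?_
      have ht' : t ∩ B = π := by simpa using ht
      rw [hPccell t ht', hPcell t ht']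
      simp only [hΦ]; ring
    rw [hsum, sub_nonneg]
    exact cell_sum_mul_flip_le B π hπB Φ G hΦm hGm
  rw [step1, step2]
  linarith [step3]

open Classical in
/-- **Corollary (CW-PA ⟸ DOM_z).**  If the zone-flip comparison is nonnegative,
`0 ≤ Σ_{s∈S} (f(C_x s) − f(C_x(P_z s)))·(g(C_x s) − g(C_x(P_z s)))`, then the first rung CW-PA holds for `(x, z, f, g)`:
`0 ≤ Σ_{s∈S} (f(C_x s) − f(C_x sᶜ))·(g(C_x s) − g(C_x sᶜ))`. [this work] -/
theorem cwpa_of_zoneFlip_nonneg (x : V) (f g : Set V → ℝ) (hf : Monotone f) (hg : Monotone g)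
    (hz : 0 ≤ ∑ s ∈ univ.filter (fun s : Finset ι => z ∉ (openCluster (ends '' (↑(s) : Set ι)) (x)) ∧ z ∉ (openCluster (ends '' (↑(sᶜ) : Set ι)) (x))),
        (f (openCluster (ends '' (↑(s) : Set ι)) (x)) - f (openCluster (ends '' (↑((symmDiff (s) (Finset.univ.filter (fun i : ι => ∃ v, (v ∈ (openCluster (ends '' (↑(s) : Set ι)) (z)) ∨ v ∈ (openCluster (ends '' (↑((s)ᶜ) : Set ι)) (z))) ∧ v ∈ ends i)))) : Set ι)) (x))) * (g (openCluster (ends '' (↑(s) : Set ι)) (x)) - g (openCluster (ends '' (↑((symmDiff (s) (Finset.univ.filter (fun i : ι => ∃ v, (v ∈ (openCluster (ends '' (↑(s) : Set ι)) (z)) ∨ v ∈ (openCluster (ends '' (↑((s)ᶜ) : Set ι)) (z))) ∧ v ∈ ends i)))) : Set ι)) (x)))) :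
    0 ≤ ∑ s ∈ univ.filter (fun s : Finset ι => z ∉ (openCluster (ends '' (↑(s) : Set ι)) (x)) ∧ z ∉ (openCluster (ends '' (↑(sᶜ) : Set ι)) (x))),
        (f (openCluster (ends '' (↑(s) : Set ι)) (x)) - f (openCluster (ends '' (↑(sᶜ) : Set ι)) (x))) * (g (openCluster (ends '' (↑(s) : Set ι)) (x)) - g (openCluster (ends '' (↑(sᶜ) : Set ι)) (x))) := by
  have hK := cwpa_ge_half_zoneFlip ends z x f g hf hg
  set S : Finset (Finset ι) := univ.filter (fun s : Finset ι => z ∉ (openCluster (ends '' (↑(s) : Set ι)) (x)) ∧ z ∉ (openCluster (ends '' (↑(sᶜ) : Set ι)) (x))) with hS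
  set F : Finset ι → ℝ := fun s => f (openCluster (ends '' (↑(s) : Set ι)) (x)) with hF
  set G : Finset ι → ℝ := fun s => g (openCluster (ends '' (↑(s) : Set ι)) (x)) with hG
  have mem_S : ∀ s, s ∈ S ↔ z ∉ (openCluster (ends '' (↑(s) : Set ι)) (x)) ∧ z ∉ (openCluster (ends '' (↑(sᶜ) : Set ι)) (x)) := fun s => by simp [hS]
  have hcS : ∀ s ∈ S, sᶜ ∈ S := fun s hs => by
    rw [mem_S] at hs ⊢; rw [compl_compl]; exact ⟨hs.2, hs.1⟩
  -- the symmetric form is twice the one-sided form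
  have reindexC : ∀ Ψ : Finset ι → ℝ, ∑ s ∈ S, Ψ sᶜ = ∑ s ∈ S, Ψ s := by
    intro Ψ
    refine Finset.sum_bij' (fun s _ => sᶜ) (fun s _ => sᶜ) ?_ ?_ ?_ ?_ ?_
    · intro s hs; exact hcS s hs
    · intro s hs; exact hcS s hs
    · intro s hs; exact compl_compl s
    · intro s hs; exact compl_compl s
    · intro s hs; rfl
  have hsym : ∑ s ∈ S, (F s - F sᶜ) * (G s - G sᶜ) = 2 * ∑ s ∈ S, F s * (G s - G sᶜ) := by
    have e : ∀ s, (F s - F sᶜ) * (G s - G sᶜ) = F s * (G s - G sᶜ) + F sᶜ * (G sᶜ - G s) := fun s => by ring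
    simp only [e, Finset.sum_add_distrib]
    have h2 : ∑ s ∈ S, F sᶜ * (G sᶜ - G s) = ∑ s ∈ S, F s * (G s - G sᶜ) := by
      have := reindexC (fun s => F s * (G s - G sᶜ))
      rw [← this]
      refine Finset.sum_congr rfl fun s _ => ?_
      simp only [compl_compl]
    rw [h2]; ring
  change 0 ≤ ∑ s ∈ S, (F s - F sᶜ) * (G s - G sᶜ)
  rw [hsym]
  change ∑ s ∈ S, (F s - f (openCluster (ends '' (↑((symmDiff (s) (Finset.univ.filter (fun i : ι => ∃ v, (v ∈ (openCluster (ends '' (↑(s) : Set ι)) (z)) ∨ v ∈ (openCluster (ends '' (↑((s)ᶜ) : Set ι)) (z))) ∧ v ∈ ends i)))) : Set ι)) (x))) * (G s - g (openCluster (ends '' (↑((symmDiff (s) (Finset.univ.filter (fun i : ι => ∃ v, (v ∈ (openCluster (ends '' (↑(s) : Set ι)) (z)) ∨ v ∈ (openCluster (ends '' (↑((s)ᶜ) : Set ι)) (z))) ∧ v ∈ ends i)))) : Set ι)) (x))) ≤ 2 * ∑ s ∈ S, F s * (G s - G sᶜ) at hK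
  linarith [hK, hz]

end Coefficientwise

end Summit.CriticalPhenomena.PercolationContinuityZ3.Theorems
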